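import Mathlib
import HarnessLib
import Summits.ValiantsHypothesis.ValiantsHypothesis.Theorems.LacunarySymmetroidMatrixDescartesProductPlusOneTameSector
import Summits.ValiantsHypothesis.ValiantsHypothesis.Theorems.LacunarySymmetroidMatrixDescartesProductPlusOneTameReverse

/-!
# ValiantsHypothesis / LacunarySymmetroid — crux `MatrixDescartes` (stmt-ValiantsHypothesis-18050, V1),
# LINE (A) «product_plus_one», `stub_classRowK3` calibration: the SIGN-AWARE tame count `Z₊ ≤ m + 2`

Sharpening of ✓ `ProductPlusOne.tame_sector_pos_roots` (`≤ 2m + 2`, p650274) to the constant priced by crit-6 READ #13: in the tame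
sector (`a_j c_j < 0`, ratio `≤ 4`) every member `κ + ∏_j g_j` has at most `m + 2` positive zeros (`m` is realised).  Mechanism, with no
multiplicity bookkeeping: a no-dip factor takes the sign of `a_j` below its unique positive zero and the opposite sign above it
(`sign_below_zero`, `sign_above_zero`), so along `(0,∞)` the count `c(x) = #{j : a_j g_j(x) < 0}` of «switched» factors never decreases and
two member zeros with equal `c` bound a factor-zero-free interval; p7 g14's fibre argument (Rolle twice + ✓ `psi_injective`) gives fibres
`≤ 2`; and at a member zero `(∏ a_j)·(−κ) = ∏_j (a_j g_j(z))` has the sign `(−1)^{c(z)}`, so `c` has a FIXED PARITY on the zero set —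
at most `⌊m/2⌋ + 1` values — whence `Z₊ ≤ m + 2` (`tame_sector_pos_roots_signed`; line shape `tame_sector_class_signed`).

Honest framing: calibration of a sector rung; NOT `stub_classRowK3` / `MatrixDescartes` / B; `VP ≠ VNP` NOT proved.  No defs/facts.
-/

set_option linter.dupNamespace false

namespace Summit.ValiantsHypothesis.ValiantsHypothesis.Theorems.LacunarySymmetroidMatrixDescartes

namespace ProductPlusOne

open Polynomial Finset
open scoped BigOperators
/-! ### One no-dip factor: unique positive zero and the sign on either side -/

/-- Two positive zeros of a no-dip trinomial coincide. [folklore; ✓ `trinomial_pos_roots_le_one`] -/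
theorem pos_zero_unique (a b c : ℝ) (e k : ℕ) (hac : a * c < 0) {z z' : ℝ} (hz : 0 < z) (hz' : 0 < z')
    (hgz : a + b * z ^ (e + 1) + c * z ^ (e + k + 2) = 0) (hgz' : a + b * z' ^ (e + 1) + c * z' ^ (e + k + 2) = 0) : z = z' := by
  classical
  have h1 := trinomial_pos_roots_le_one a b c e k hac
  have hmem : ∀ w : ℝ, 0 < w → a + b * w ^ (e + 1) + c * w ^ (e + k + 2) = 0 →
      w ∈ ((C a + C b * X ^ (e + 1) + C c * X ^ (e + k + 2) : ℝ[X]).roots.toFinset.filter (fun t => 0 < t)) := by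
    intro w hw hgw
    rw [mem_filter, Multiset.mem_toFinset, mem_roots (trinomial_ne_zero a b c e k hac), IsRoot.def, eval_trinomial]
    exact ⟨hgw, hw⟩
  exact Finset.card_le_one.mp h1 z (hmem z hz hgz) z' (hmem z' hz' hgz')

/-- If `a·g(x) < 0` at some `x > 0`, the factor vanishes in `(0, x)` (`g(0) = a`). [folklore] -/
theorem exists_zero_below (a b c : ℝ) (e k : ℕ) {x : ℝ} (hx : 0 < x) (hneg : a * (a + b * x ^ (e + 1) + c * x ^ (e + k + 2)) < 0) :
    ∃ t ∈ Set.Ioo 0 x, a + b * t ^ (e + 1) + c * t ^ (e + k + 2) = 0 := by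
  have hcont : ContinuousOn (fun t : ℝ => a * (a + b * t ^ (e + 1) + c * t ^ (e + k + 2))) (Set.Icc 0 x) := by fun_prop
  have h0 : 0 ≤ a * (a + b * (0:ℝ) ^ (e + 1) + c * (0:ℝ) ^ (e + k + 2)) := by
    simp only [zero_pow (Nat.succ_ne_zero _), mul_zero, add_zero, show e + k + 2 = (e + k + 1) + 1 by omega]
    exact mul_self_nonneg a
  -- intermediate value on `[0, x]` for the continuous function `t ↦ a g(t)`, from `≥ 0` to `< 0`
  obtain ⟨t, ht, ht0⟩ := intermediate_value_Icc' hx.le hcont ⟨hneg.le, h0⟩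
  have ht0' : a * (a + b * t ^ (e + 1) + c * t ^ (e + k + 2)) = 0 := ht0
  have ha : a ≠ 0 := by rintro rfl; simp at hneg
  rcases eq_or_lt_of_le ht.1 with h | h
  · -- t = 0 impossible unless a = 0
    subst h
    simp only [zero_pow (Nat.succ_ne_zero _), mul_zero, add_zero, show e + k + 2 = (e + k + 1) + 1 by omega] at ht0'
    exact absurd (mul_self_eq_zero.1 ht0') ha
  rcases eq_or_lt_of_le ht.2 with h' | h'
  · subst h'; rw [ht0'] at hneg; exact absurd hneg (lt_irrefl 0)
  exact ⟨t, ⟨h, h'⟩, (mul_eq_zero.1 ht0').resolve_left ha⟩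

/-- If `a·g(x) > 0` at some `x > 0` and `a c < 0`, the factor vanishes in `(x, ∞)` (the top term wins). [folklore] -/
theorem exists_zero_above (a b c : ℝ) (e k : ℕ) (hac : a * c < 0) {x : ℝ} (hx : 0 < x)
    (hpos : 0 < a * (a + b * x ^ (e + 1) + c * x ^ (e + k + 2))) :
    ∃ t : ℝ, x < t ∧ a + b * t ^ (e + 1) + c * t ^ (e + k + 2) = 0 := by
  -- an explicit point `y > x`, `y ≥ 1`, where `a g(y) < 0`
  set y : ℝ := max (x + 1) ((|a * b| + a * a + 1) / (-(a * c))) with hy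
  have hac' : 0 < -(a * c) := neg_pos.2 hac
  have hy1 : 1 ≤ y := by have : x + 1 ≤ y := le_max_left _ _; linarith
  have hyx : x < y := by have := le_max_left (x + 1) ((|a * b| + a * a + 1) / (-(a * c))); linarith
  have hy0 : 0 < y := hx.trans hyx
  have hbig : |a * b| + a * a + 1 ≤ -(a * c) * y := by
    have h := le_max_right (x + 1) ((|a * b| + a * a + 1) / (-(a * c)))
    rw [hy.symm, div_le_iff₀ hac'] at h
    linarith [mul_comm y (-(a * c))]
  have hneg : a * (a + b * y ^ (e + 1) + c * y ^ (e + k + 2)) < 0 := by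
    have hp1 : 1 ≤ y ^ (e + k + 1) := one_le_pow₀ hy1
    have hmono : y ^ (e + 1) ≤ y ^ (e + k + 1) := pow_le_pow_right₀ hy1 (by omega)
    have hsplit : a * (a + b * y ^ (e + 1) + c * y ^ (e + k + 2))
        = a * a + a * b * y ^ (e + 1) + (a * c) * y * y ^ (e + k + 1) := by ring
    rw [hsplit]
    have h1a : a * b * y ^ (e + 1) ≤ |a * b| * y ^ (e + 1) := mul_le_mul_of_nonneg_right (le_abs_self _) (pow_nonneg hy0.le _)
    have h1b : |a * b| * y ^ (e + 1) ≤ |a * b| * y ^ (e + k + 1) := mul_le_mul_of_nonneg_left hmono (abs_nonneg _)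
    have h2 : (a * c) * y * y ^ (e + k + 1) ≤ -(|a * b| + a * a + 1) * y ^ (e + k + 1) :=
      mul_le_mul_of_nonneg_right (by linarith) (pow_nonneg hy0.le _)
    have h3 : a * a + 1 ≤ (a * a + 1) * y ^ (e + k + 1) :=
      le_mul_of_one_le_right (by nlinarith [mul_self_nonneg a]) hp1
    linarith
  -- intermediate value on `[x, y]`
  have hcont : ContinuousOn (fun t : ℝ => a * (a + b * t ^ (e + 1) + c * t ^ (e + k + 2))) (Set.Icc x y) := by fun_prop
  obtain ⟨t, ht, ht0⟩ := intermediate_value_Icc' hyx.le hcont ⟨hneg.le, hpos.le⟩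
  have ht0' : a * (a + b * t ^ (e + 1) + c * t ^ (e + k + 2)) = 0 := ht0
  have ha : a ≠ 0 := by rintro rfl; simp at hpos
  rcases eq_or_lt_of_le ht.1 with h | h
  · subst h; rw [ht0'] at hpos; exact absurd hpos (lt_irrefl 0)
  exact ⟨t, h, (mul_eq_zero.1 ht0').resolve_left ha⟩

/-- **Sign below the zero**: if the factor vanishes at `t` and `0 < x < t`, then `a·g(x) > 0`. [folklore] -/
theorem sign_below_zero (a b c : ℝ) (e k : ℕ) (hac : a * c < 0) {t x : ℝ} (hx : 0 < x) (hxt : x < t)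
    (hgt : a + b * t ^ (e + 1) + c * t ^ (e + k + 2) = 0) (hgx : a + b * x ^ (e + 1) + c * x ^ (e + k + 2) ≠ 0) :
    0 < a * (a + b * x ^ (e + 1) + c * x ^ (e + k + 2)) := by
  have ha : a ≠ 0 := by rintro rfl; rw [zero_mul] at hac; exact lt_irrefl 0 hac
  rcases lt_trichotomy (a * (a + b * x ^ (e + 1) + c * x ^ (e + k + 2))) 0 with h | h | h
  · obtain ⟨s, hs, hgs⟩ := exists_zero_below a b c e k hx h
    exact absurd (pos_zero_unique a b c e k hac hs.1 (hx.trans hxt) hgs hgt) (hs.2.trans hxt).ne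
  · exact absurd ((mul_eq_zero.1 h).resolve_left ha) hgx
  · exact h

/-- **Sign above the zero**: if the factor vanishes at `t > 0` and `t < x`, then `a·g(x) < 0`. [folklore] -/
theorem sign_above_zero (a b c : ℝ) (e k : ℕ) (hac : a * c < 0) {t x : ℝ} (ht : 0 < t) (htx : t < x)
    (hgt : a + b * t ^ (e + 1) + c * t ^ (e + k + 2) = 0) (hgx : a + b * x ^ (e + 1) + c * x ^ (e + k + 2) ≠ 0) :
    a * (a + b * x ^ (e + 1) + c * x ^ (e + k + 2)) < 0 := by
  have ha : a ≠ 0 := by rintro rfl; rw [zero_mul] at hac; exact lt_irrefl 0 hac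
  rcases lt_trichotomy (a * (a + b * x ^ (e + 1) + c * x ^ (e + k + 2))) 0 with h | h | h
  · exact h
  · exact absurd ((mul_eq_zero.1 h).resolve_left ha) hgx
  · obtain ⟨s, hs, hgs⟩ := exists_zero_above a b c e k hac (ht.trans htx) h
    exact absurd (pos_zero_unique a b c e k hac ht ((ht.trans htx).trans hs) hgt hgs) (htx.trans hs).ne

/-- **Switched factors stay switched**: `a·g(x₁) < 0`, `x₁ < x₂`, `g(x₂) ≠ 0` ⇒ `a·g(x₂) < 0`. [folklore] -/
theorem switched_mono (a b c : ℝ) (e k : ℕ) (hac : a * c < 0) {x₁ x₂ : ℝ} (hx₁ : 0 < x₁) (h12 : x₁ < x₂)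
    (h1 : a * (a + b * x₁ ^ (e + 1) + c * x₁ ^ (e + k + 2)) < 0) (hg2 : a + b * x₂ ^ (e + 1) + c * x₂ ^ (e + k + 2) ≠ 0) :
    a * (a + b * x₂ ^ (e + 1) + c * x₂ ^ (e + k + 2)) < 0 := by
  obtain ⟨t, ht, hgt⟩ := exists_zero_below a b c e k hx₁ h1
  exact sign_above_zero a b c e k hac ht.1 (ht.2.trans h12) hgt hg2
/-! ### Sign of a product via the number of negative factors -/

/-- `∏ f = (−1)^{#neg} · ∏ |f|`. [folklore] -/
theorem prod_eq_neg_one_pow_mul_prod_abs {ι : Type*} (s : Finset ι) (f : ι → ℝ) :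
    ∏ i ∈ s, f i = (-1) ^ (s.filter (fun i => f i < 0)).card * ∏ i ∈ s, |f i| := by
  classical
  have h : ∀ i ∈ s, f i = (if f i < 0 then (-1 : ℝ) else 1) * |f i| := by
    intro i _
    split_ifs with hi
    · rw [abs_of_neg hi]; ring
    · rw [abs_of_nonneg (not_lt.1 hi), one_mul]
  rw [Finset.prod_congr rfl h, Finset.prod_mul_distrib, Finset.prod_ite, Finset.prod_const, Finset.prod_const_one, mul_one]

/-- Hence, for nonvanishing factors: `0 < ∏ f ↔ #neg is even`. [folklore] -/
theorem prod_pos_iff_even {ι : Type*} (s : Finset ι) (f : ι → ℝ) (hf : ∀ i ∈ s, f i ≠ 0) :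
    0 < ∏ i ∈ s, f i ↔ Even (s.filter (fun i => f i < 0)).card := by
  classical
  have habs : 0 < ∏ i ∈ s, |f i| := Finset.prod_pos (fun i hi => abs_pos.2 (hf i hi))
  rw [prod_eq_neg_one_pow_mul_prod_abs]
  constructor
  · intro h
    have h1 : 0 < (-1 : ℝ) ^ (s.filter (fun i => f i < 0)).card := pos_of_mul_pos_left h habs.le
    by_contra hodd
    rw [Nat.not_even_iff_odd] at hodd
    rw [hodd.neg_one_pow] at h1
    linarith
  · intro h
    rw [h.neg_one_pow, one_mul]
    exact habs

/-- Values of one parity in `{0,…,m}` number at most `m/2 + 1`. [folklore] -/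
theorem card_range_filter_mod_two_le (m π : ℕ) :
    ((Finset.range (m + 1)).filter (fun v => v % 2 = π)).card ≤ m / 2 + 1 := by
  classical
  calc ((Finset.range (m + 1)).filter (fun v => v % 2 = π)).card
      ≤ (Finset.range (m / 2 + 1)).card := by
        refine Finset.card_le_card_of_injOn (fun v => v / 2) (fun v hv => ?_) (fun v hv w hw hvw => ?_)
        · rw [Finset.mem_coe, Finset.mem_filter, Finset.mem_range] at hv
          rw [Finset.mem_coe, Finset.mem_range]
          show v / 2 < m / 2 + 1
          omega
        · rw [Finset.mem_coe, Finset.mem_filter] at hv hw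
          simp only at hvw
          omega
    _ = m / 2 + 1 := Finset.card_range _
/-! ### The signed count -/

/-- ★ **THE SIGN-AWARE TAME COUNT**: `Z₊(κ + ∏_j g_j) ≤ m + 2` for no-dip trinomials `g_j = a_j + b_j X^{e+1} + c_j X^{e+k+2}`
(`a_j c_j < 0`) with `k ≤ 3e + 2` (ratio `≤ 4`), every real `κ`, every `m`. [this file's theorem] -/
theorem tame_sector_pos_roots_signed {m : ℕ} (a b c : Fin m → ℝ) (e k : ℕ) (hk : k ≤ 3 * e + 2)
    (hac : ∀ j, a j * c j < 0) (κ : ℝ) :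
    ((C κ + ∏ j, (C (a j) + C (b j) * X ^ (e + 1) + C (c j) * X ^ (e + k + 2))).roots.toFinset.filter
      (fun t => 0 < t)).card ≤ m + 2 := by
  classical
  set P : ℝ[X] := ∏ j, (C (a j) + C (b j) * X ^ (e + 1) + C (c j) * X ^ (e + k + 2)) with hPdef
  rcases Nat.eq_zero_or_pos m with hm | hm
  · subst hm
    have hP1 : P = 1 := by rw [hPdef]; exact Fintype.prod_empty _
    rw [hP1, ← C_1, ← C_add, roots_C, Multiset.toFinset_zero, Finset.filter_empty, Finset.card_empty]
    exact Nat.zero_le _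
  have hP0 : P ≠ 0 := prod_trinomial_ne_zero a b c e k hac
  by_cases hκ : κ = 0
  · subst hκ
    rw [map_zero, zero_add]
    exact (prod_trinomial_pos_roots_le a b c e k hac).trans (by omega)
  set S := (C κ + P).roots.toFinset.filter (fun t => 0 < t) with hSdef
  -- the switched-factor count
  set cnt : ℝ → ℕ := fun z => (Finset.univ.filter (fun j => a j * (a j + b j * z ^ (e + 1) + c j * z ^ (e + k + 2)) < 0)).card
    with hcnt
  have hSmem : ∀ z ∈ S, 0 < z ∧ eval z (C κ + P) = 0 := by
    intro z hz
    rw [hSdef, mem_filter, Multiset.mem_toFinset] at hz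
    by_cases h0 : C κ + P = 0
    · rw [h0, roots_zero] at hz
      exact absurd hz.1 (Multiset.notMem_zero _)
    · exact ⟨hz.2, (IsRoot.def).mp ((mem_roots h0).mp hz.1)⟩
  have hPz : ∀ z ∈ S, eval z P = -κ := by
    intro z hz
    have h := (hSmem z hz).2
    rw [eval_add, eval_C] at h
    linarith
  have hgne : ∀ z ∈ S, ∀ j, a j + b j * z ^ (e + 1) + c j * z ^ (e + k + 2) ≠ 0 := by
    intro z hz j hj
    have h := hPz z hz
    rw [hPdef, eval_prod_trinomial] at h
    have : (∏ j, (a j + b j * z ^ (e + 1) + c j * z ^ (e + k + 2))) = 0 := Finset.prod_eq_zero (Finset.mem_univ j) hj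
    rw [this] at h
    exact hκ (by linarith)
  -- (1) equal counts bound a factor-zero-free interval
  have hfree : ∀ z₁ ∈ S, ∀ z₃ ∈ S, z₁ < z₃ → cnt z₁ = cnt z₃ →
      ∀ t ∈ Set.Icc z₁ z₃, ∀ j, a j + b j * t ^ (e + 1) + c j * t ^ (e + k + 2) ≠ 0 := by
    intro z₁ hz₁ z₃ hz₃ h13 hc t ht j hj
    have hz₁0 := (hSmem z₁ hz₁).1
    have hsub : Finset.univ.filter (fun j => a j * (a j + b j * z₁ ^ (e + 1) + c j * z₁ ^ (e + k + 2)) < 0)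
        ⊆ Finset.univ.filter (fun j => a j * (a j + b j * z₃ ^ (e + 1) + c j * z₃ ^ (e + k + 2)) < 0) := by
      intro i hi
      rw [mem_filter] at hi ⊢
      exact ⟨mem_univ _, switched_mono (a i) (b i) (c i) e k (hac i) hz₁0 h13 hi.2 (hgne z₃ hz₃ i)⟩
    have heq := Finset.eq_of_subset_of_card_le hsub (le_of_eq hc.symm)
    rcases eq_or_lt_of_le ht.1 with h1 | h1
    · exact hgne z₁ hz₁ j (h1 ▸ hj)
    rcases eq_or_lt_of_le ht.2 with h3 | h3
    · exact hgne z₃ hz₃ j (h3 ▸ hj)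
    have hbelow := sign_below_zero (a j) (b j) (c j) e k (hac j) hz₁0 h1 hj (hgne z₁ hz₁ j)
    have habove := sign_above_zero (a j) (b j) (c j) e k (hac j) (hz₁0.trans h1) h3 hj (hgne z₃ hz₃ j)
    have hj3 : j ∈ Finset.univ.filter (fun j => a j * (a j + b j * z₃ ^ (e + 1) + c j * z₃ ^ (e + k + 2)) < 0) := by
      rw [mem_filter]; exact ⟨mem_univ _, habove⟩
    rw [← heq, mem_filter] at hj3
    exact absurd hj3.2 (not_lt.2 hbelow.le)
  -- (2) a zero of `P′` in a zero-free region is a zero of `Ψ`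
  have hΨzero : ∀ w : ℝ, 0 < w → (∀ j, a j + b j * w ^ (e + 1) + c j * w ^ (e + k + 2) ≠ 0) →
      eval w (derivative P) = 0 →
      (∑ j, ((e + 1 : ℝ) * b j + (e + k + 2 : ℝ) * c j * w ^ (k + 1))
          / (a j + b j * w ^ (e + 1) + c j * w ^ (e + k + 2))) = 0 := by
    intro w hw hg hd
    rw [hPdef, eval_derivative_prod a b c e k hg] at hd
    rcases mul_eq_zero.mp hd with h | h
    · rcases mul_eq_zero.mp h with h' | h'
      · exact absurd h' (Finset.prod_ne_zero_iff.mpr (fun j _ => hg j))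
      · exact absurd h' (pow_ne_zero _ hw.ne')
    · exact h
  -- (3) every fibre of `cnt` on `S` has at most two elements (p7 g14's argument)
  have hfiber : ∀ v ∈ S.image cnt, (S.filter (fun z => cnt z = v)).card ≤ 2 := by
    intro v _
    by_contra hcon
    push Not at hcon
    set F := S.filter (fun z => cnt z = v) with hF
    have hFS : ∀ z ∈ F, z ∈ S ∧ cnt z = v := by
      intro z hz
      rw [hF, mem_filter] at hz
      exact hz
    have hne : F.Nonempty := Finset.card_pos.mp (by omega)
    have hz₁F : F.min' hne ∈ F := Finset.min'_mem F hne
    have hF₁card : 2 ≤ (F.erase (F.min' hne)).card := by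
      rw [Finset.card_erase_of_mem hz₁F]
      omega
    have hne₁ : (F.erase (F.min' hne)).Nonempty := Finset.card_pos.mp (by omega)
    have hz₂F₁ : (F.erase (F.min' hne)).min' hne₁ ∈ F.erase (F.min' hne) := Finset.min'_mem _ hne₁
    have hne₂ : ((F.erase (F.min' hne)).erase ((F.erase (F.min' hne)).min' hne₁)).Nonempty :=
      Finset.card_pos.mp (by rw [Finset.card_erase_of_mem hz₂F₁]; omega)
    obtain ⟨z₃, hz₃F₂⟩ := hne₂
    set z₁ := F.min' hne with hz₁
    set z₂ := (F.erase z₁).min' hne₁ with hz₂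
    have hz₂F : z₂ ∈ F := Finset.mem_of_mem_erase hz₂F₁
    have hz₃F₁ : z₃ ∈ F.erase z₁ := Finset.mem_of_mem_erase hz₃F₂
    have hz₃F : z₃ ∈ F := Finset.mem_of_mem_erase hz₃F₁
    have h12 : z₁ < z₂ :=
      lt_of_le_of_ne (Finset.min'_le F z₂ hz₂F) (Finset.ne_of_mem_erase hz₂F₁).symm
    have h23 : z₂ < z₃ :=
      lt_of_le_of_ne (Finset.min'_le _ z₃ hz₃F₁) (Finset.ne_of_mem_erase hz₃F₂).symm
    obtain ⟨hz₁S, hk₁⟩ := hFS z₁ hz₁F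
    obtain ⟨hz₂S, _⟩ := hFS z₂ hz₂F
    obtain ⟨hz₃S, hk₃⟩ := hFS z₃ hz₃F
    have free13 := hfree z₁ hz₁S z₃ hz₃S (h12.trans h23) (hk₁.trans hk₃.symm)
    obtain ⟨w₁, hw₁, hd₁⟩ := exists_deriv_root_between a b c e k κ h12 (hSmem z₁ hz₁S).2 (hSmem z₂ hz₂S).2
    obtain ⟨w₂, hw₂, hd₂⟩ := exists_deriv_root_between a b c e k κ h23 (hSmem z₂ hz₂S).2 (hSmem z₃ hz₃S).2
    have hw₁pos : 0 < w₁ := (hSmem z₁ hz₁S).1.trans hw₁.1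
    have hw₁₂ : w₁ < w₂ := hw₁.2.trans hw₂.1
    have hIcc : Set.Icc w₁ w₂ ⊆ Set.Icc z₁ z₃ :=
      fun t ht => ⟨hw₁.1.le.trans ht.1, ht.2.trans hw₂.2.le⟩
    have hg₁ := free13 w₁ (hIcc ⟨le_rfl, hw₁₂.le⟩)
    have hg₂ := free13 w₂ (hIcc ⟨hw₁₂.le, le_rfl⟩)
    have hΨ₁ := hΨzero w₁ hw₁pos hg₁ hd₁
    have hΨ₂ := hΨzero w₂ (hw₁pos.trans hw₁₂) hg₂ hd₂
    exact psi_injective hm a b c e k hk hac hw₁pos hw₁₂ (fun t ht => free13 t (hIcc ht)) (hΨ₁.trans hΨ₂.symm)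
  -- (4) the parity of `cnt` is fixed on `S`
  have hparity : ∀ z ∈ S, (Even (cnt z) ↔ 0 < (∏ j, a j) * (-κ)) := by
    intro z hz
    have hprod : (∏ j, a j) * (-κ) = ∏ j, (a j * (a j + b j * z ^ (e + 1) + c j * z ^ (e + k + 2))) := by
      rw [Finset.prod_mul_distrib, ← eval_prod_trinomial, ← hPdef, hPz z hz]
    rw [hprod, prod_pos_iff_even _ _ (fun j _ => mul_ne_zero ?_ (hgne z hz j))]
    rintro h0; have := hac j; rw [h0, zero_mul] at this; exact lt_irrefl 0 this
  -- (5) count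
  set π : ℕ := if 0 < (∏ j, a j) * (-κ) then 0 else 1 with hπ
  have himg : S.image cnt ⊆ (Finset.range (m + 1)).filter (fun v => v % 2 = π) := by
    intro v hv
    rw [Finset.mem_image] at hv
    obtain ⟨z, hzS, rfl⟩ := hv
    rw [Finset.mem_filter, Finset.mem_range]
    refine ⟨Nat.lt_succ_of_le ((Finset.card_filter_le _ _).trans (by rw [Finset.card_univ, Fintype.card_fin])), ?_⟩
    rw [hπ]
    split_ifs with hs
    · exact Nat.even_iff.1 ((hparity z hzS).2 hs)
    · exact Nat.odd_iff.1 (Nat.not_even_iff_odd.1 (fun hev => hs ((hparity z hzS).1 hev)))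
  calc S.card = ∑ v ∈ S.image cnt, (S.filter (fun z => cnt z = v)).card := Finset.card_eq_sum_card_image _ S
    _ ≤ ∑ _v ∈ S.image cnt, 2 := Finset.sum_le_sum hfiber
    _ = 2 * (S.image cnt).card := by rw [Finset.sum_const, smul_eq_mul, mul_comm]
    _ ≤ 2 * (m / 2 + 1) :=
        Nat.mul_le_mul_left 2 ((Finset.card_le_card himg).trans (card_range_filter_mod_two_le m π))
    _ ≤ m + 2 := by omega

/-- ★ **THE SIGN-AWARE TAME COUNT, line shape** (`C c * X ^ (m * d 0) + ∏ j, fewnomial d (a j)` unfolded verbatim; bottom coupling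
`l₀ = 0`, `d 0 < d 1 < d 2`, `d 2 − d 0 ≤ 4 (d 1 − d 0)`, `a j 0 · a j 2 < 0`): at most `m + 2` positive zeros. [this file's theorem] -/
theorem tame_sector_class_signed {m : ℕ} (d : Fin 3 → ℕ) (h01 : d 0 < d 1) (h12 : d 1 < d 2)
    (h4 : d 2 - d 0 ≤ 4 * (d 1 - d 0)) (a : Fin m → Fin 3 → ℝ) (hac : ∀ j, a j 0 * a j 2 < 0) (c : ℝ) :
    ((C c * X ^ (m * d 0) + ∏ j, ∑ l, C (a j l) * X ^ (d l) : ℝ[X]).roots.toFinset.filter (fun t => 0 < t)).card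
      ≤ m + 2 := by
  classical
  obtain ⟨e, he⟩ : ∃ e, d 1 = d 0 + e + 1 := ⟨d 1 - d 0 - 1, by omega⟩
  obtain ⟨k, hk⟩ : ∃ k, d 2 = d 0 + e + k + 2 := ⟨d 2 - d 1 - 1, by omega⟩
  have hk3 : k ≤ 3 * e + 2 := by omega
  have hfac : ∀ j, (∑ l, C (a j l) * X ^ (d l) : ℝ[X])
      = X ^ (d 0) * (C (a j 0) + C (a j 1) * X ^ (e + 1) + C (a j 2) * X ^ (e + k + 2)) := by
    intro j
    rw [Fin.sum_univ_three, he, hk]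
    ring
  have hmem : (C c * X ^ (m * d 0) + ∏ j, ∑ l, C (a j l) * X ^ (d l) : ℝ[X])
      = X ^ (m * d 0) * (C c + ∏ j, (C (a j 0) + C (a j 1) * X ^ (e + 1) + C (a j 2) * X ^ (e + k + 2))) := by
    rw [Finset.prod_congr rfl (fun j _ => hfac j), Finset.prod_mul_distrib, Finset.prod_const, Finset.card_univ,
      Fintype.card_fin, ← pow_mul, mul_comm (d 0) m]
    ring
  rw [hmem]
  by_cases h0 : (X ^ (m * d 0) * (C c + ∏ j, (C (a j 0) + C (a j 1) * X ^ (e + 1) + C (a j 2) * X ^ (e + k + 2)))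
      : ℝ[X]) = 0
  · rw [h0, roots_zero, Multiset.toFinset_zero, Finset.filter_empty, Finset.card_empty]
    exact Nat.zero_le _
  · rw [roots_mul h0, roots_pow, roots_X, Multiset.toFinset_add, Finset.filter_union]
    refine (Finset.card_union_le _ _).trans ?_
    have hz : (((m * d 0) • ({0} : Multiset ℝ)).toFinset.filter (fun t => 0 < t)) = ∅ := by
      rw [Finset.filter_eq_empty_iff]
      intro t ht
      rw [Multiset.mem_toFinset] at ht
      have h00 := Multiset.mem_singleton.mp (Multiset.mem_of_mem_nsmul ht)
      rw [h00]
      exact lt_irrefl 0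
    rw [hz, Finset.card_empty, zero_add]
    exact tame_sector_pos_roots_signed (fun j => a j 0) (fun j => a j 1) (fun j => a j 2) e k hk3 hac c

/-- ★ **THE SIGN-AWARE TAME COUNT at the TOP coupling** (`l₀ = 2`, ratio `d 2 − d 0 ≤ 4 (d 2 − d 1)`): at most `m + 2` positive zeros
(p7 g14's reversal ✓ `card_pos_roots_class_reverse` + `tame_sector_class_signed` for the reversed data). [this file's theorem] -/
theorem tame_sector_class_signed_top {m : ℕ} (d : Fin 3 → ℕ) (h01 : d 0 < d 1) (h12 : d 1 < d 2)
    (h4 : d 2 - d 0 ≤ 4 * (d 2 - d 1)) (a : Fin m → Fin 3 → ℝ) (hac : ∀ j, a j 0 * a j 2 < 0) (c : ℝ) :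
    ((C c * X ^ (m * d 2) + ∏ j, ∑ l, C (a j l) * X ^ (d l) : ℝ[X]).roots.toFinset.filter (fun t => 0 < t)).card
      ≤ m + 2 := by
  have hD : ∀ l : Fin 3, d l ≤ d 2 := by
    intro l; fin_cases l
    · exact (h01.trans h12).le
    · exact h12.le
    · exact le_rfl
  have hrev := card_pos_roots_class_reverse d (d 2) hD a 2 c
  rw [← hrev, Nat.sub_self, mul_zero]
  have hre : (C c * X ^ 0 + ∏ j, ∑ l, C (a j l) * X ^ (d 2 - d l) : ℝ[X])
      = C c * X ^ (m * (![0, d 2 - d 1, d 2 - d 0] : Fin 3 → ℕ) 0)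
        + ∏ j, ∑ l, C ((fun j l => a j (2 - l)) j l) * X ^ ((![0, d 2 - d 1, d 2 - d 0] : Fin 3 → ℕ) l) := by
    simp only [Matrix.cons_val_zero, mul_zero]
    congr 1
    refine Finset.prod_congr rfl (fun j _ => ?_)
    simp only [Fin.sum_univ_three, Matrix.cons_val_zero, Matrix.cons_val_one, Matrix.head_cons, Matrix.cons_val_two,
      Matrix.tail_cons, Nat.sub_self]
    have e1 : (2 : Fin 3) - 0 = 2 := rfl
    have e2 : (2 : Fin 3) - 1 = 1 := rfl
    have e3 : (2 : Fin 3) - 2 = 0 := rfl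
    rw [e1, e2, e3]
    ring
  rw [hre]
  refine tame_sector_class_signed (![0, d 2 - d 1, d 2 - d 0]) ?_ ?_ ?_ (fun j l => a j (2 - l)) ?_ c
  · show 0 < d 2 - d 1
    omega
  · show d 2 - d 1 < d 2 - d 0
    omega
  · show (d 2 - d 0) - 0 ≤ 4 * ((d 2 - d 1) - 0)
    omega
  · intro j
    have e1 : (2 : Fin 3) - 0 = 2 := rfl
    have e3 : (2 : Fin 3) - 2 = 0 := rfl
    show a j (2 - 0) * a j (2 - 2) < 0
    rw [e1, e3, mul_comm]
    exact hac j

end ProductPlusOne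

end Summit.ValiantsHypothesis.ValiantsHypothesis.Theorems.LacunarySymmetroidMatrixDescartes
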